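import Summits.CriticalPhenomena.PercolationContinuityZ3.Theorems.PercNearOneGluingNoHeavyLowerTailSahiAbsorbedMember

/-!
# The head block expansion of `E_{n+1}` for EVERY (signed) weight

Support file (lane `prim-masterthm-p3`, generation 18; `--supports stmt-CriticalPhenomena-4575`).  Pure proofs, no definitions,
no `sorry`, standard axioms.

`SahiAbsorbed.sahiE_cons_eq_ex_mul_rform` expands `E_{n+1}(g, f)` along the blocks through the head slot and uses absorption
(`g · f_j = g`) to evaluate every head block moment as `E[g]`.  Here is the same expansion WITHOUT the absorption hypothesis:
  `E_{n+1}(g, f_1, …, f_n) = Σ_{S ⊆ [n]} |S|! · E[g · Π_{j∈S} f_j] · ncs(f|_{[n]∖S})`        (`sahiE_cons_eq_sum_powerset`)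
for every weight `μ : α → ℝ` (signed, unnormalised) — Lieb–Sahi's Prop. 3.4 summed over the cycles through the head, in the
lane's `ncs` bookkeeping (`ncs(∅) = 1`, `ncs(A) = −E_{|A|}` in cycle form otherwise).  It is step (1) of the SIGN⁻ programme
(HIERARCHY §26(j)): with a point-mass head under the signed slot weights of `…SahiSlotPatternSignedWeight` the head moments become
`[p_0 = y] · Π_{j∈S} F_j(y)`, and the profile term is `[p_0 = y] · Σ_{S ⊆ J_y} |S|! · ncs(tail ∖ S)`.  The absorbed formula is
recovered by `E[g · Π_S f] = E[g]` (`sahiE_cons_eq_ex_mul_rform`, re-derived below as a one-line check).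
THE VALUE-LEVEL SIGN⁻ LAW (`sahiE_cons_nonpos_of_mul_eq_zero`, `sahiE_setInd_cons_nonpos_of_disjoint`): if instead the head is
KILLED by some member (`g · f_{j₀} = 0`, e.g. `W ∩ U_{j₀} = ∅`), the head moments are `≥ 0` and the tail sub-families through `j₀`
are Sahi-positive under `μ`, then `E_{n+1}(g, f) ≤ 0` — every weight, every order; with the absorbed-member theorem this is the
value shadow of the C-slot SIGN law (`P_y ≥ 0` on `∩U_j`, `≤ 0` off it). [this work]
-/

namespace Summit.CriticalPhenomena.PercolationContinuityZ3.Theorems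

open Finset Function Equiv Equiv.Perm
open Literature.Combinatorics.Sahi2008 Literature.Combinatorics.Sahi2008.CycleForm

namespace SahiAbsorbed

section HeadBlocks

variable {α : Type*} [Fintype α] (μ : α → ℝ) {n : ℕ} (g : α → ℝ) (f : Fin n → α → ℝ)

/-- **Head block expansion, every weight**: `E_{n+1}(g, f) = Σ_{S ⊆ [n]} |S|! · E[g · Π_{j∈S} f_j] · ncs(f|_{[n]∖S})`. [this work] -/
theorem sahiE_cons_eq_sum_powerset :
    sahiE μ (n + 1) (Fin.cons g f) =
      ∑ S ∈ (univ : Finset (Fin n)).powerset,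
        (S.card.factorial : ℝ) * ex μ (fun x => g x * ∏ j ∈ S, f j x) * ncs μ f (univ \ S) := by
  classical
  rw [sahiE_eq_sum_blocks μ (by omega) (Fin.cons g f) 0]
  -- the moment of the block `insert 0 (S.map succ)` is `E[g · Π_S f]`
  have hmom : ∀ S : Finset (Fin n),
      ex μ (fun x => ∏ j ∈ insert (0 : Fin (n + 1)) (S.map (Fin.succEmb n)), (Fin.cons g f : Fin (n + 1) → α → ℝ) j x) =
        ex μ (fun x => g x * ∏ j ∈ S, f j x) := by
    intro S
    unfold ex
    refine sum_congr rfl fun x _ => ?_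
    dsimp only
    rw [prod_insert (by simp), Fin.cons_zero, prod_map]
    congr 1
  symm
  refine sum_bij (fun (S : Finset (Fin n)) _ => insert (0 : Fin (n + 1)) (S.map (Fin.succEmb n))) ?_ ?_ ?_ ?_
  · intro S _
    rw [mem_filter]
    exact ⟨mem_univ _, mem_insert_self _ _⟩
  · intro S₁ _ S₂ _ h
    have h0 : (0 : Fin (n + 1)) ∉ S₁.map (Fin.succEmb n) := by simp
    have h0' : (0 : Fin (n + 1)) ∉ S₂.map (Fin.succEmb n) := by simp
    have := congrArg (fun B => B.erase 0) h
    simp only [erase_insert h0, erase_insert h0'] at this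
    exact (map_injective (Fin.succEmb n)) this
  · intro B hB
    rw [mem_filter] at hB
    refine ⟨(B.erase 0).preimage Fin.succ (Fin.succ_injective _).injOn, mem_powerset.2 (subset_univ _), ?_⟩
    have hmp : ((B.erase 0).preimage Fin.succ (Fin.succ_injective _).injOn).map (Fin.succEmb n) = B.erase 0 := by
      ext x
      rw [mem_map]
      constructor
      · rintro ⟨y, hy, rfl⟩
        rw [mem_preimage] at hy
        exact hy
      · intro hx
        have hx0 : x ≠ 0 := ne_of_mem_erase hx
        rcases Fin.eq_zero_or_eq_succ x with rfl | ⟨k, rfl⟩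
        · exact absurd rfl hx0
        · exact ⟨k, by rw [mem_preimage]; exact hx, rfl⟩
    rw [hmp, insert_erase hB.2]
  · intro S _
    have hcard : (insert (0 : Fin (n + 1)) (S.map (Fin.succEmb n))).card = S.card + 1 := by
      rw [card_insert_of_notMem (by simp), card_map]
    rw [hcard, Nat.add_sub_cancel, hmom S]
    have hco : coRest μ (Fin.cons g f : Fin (n + 1) → α → ℝ) (insert (0 : Fin (n + 1)) (S.map (Fin.succEmb n))) =
        ncs μ f (univ \ S) := by
      unfold coRest ncs
      rw [← signedSum_comp_equiv μ (succSdiffEquiv S)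
        (fun x : {x : Fin (n + 1) // x ∉ insert (0 : Fin (n + 1)) (S.map (Fin.succEmb n))} => (Fin.cons g f : Fin (n + 1) → α → ℝ) x)]
      refine Fintype.sum_congr _ _ fun τ => ?_
      have hF : (fun j : {y : Fin n // y ∈ (univ : Finset (Fin n)) \ S} =>
          (Fin.cons g f : Fin (n + 1) → α → ℝ) ((succSdiffEquiv S j : {x : Fin (n + 1) // x ∉ insert (0 : Fin (n + 1)) (S.map (Fin.succEmb n))}) : Fin (n + 1))) =
          fun j : {y : Fin n // y ∈ (univ : Finset (Fin n)) \ S} => f (j : Fin n) := by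
        funext j
        exact Fin.cons_succ (α := fun _ => α → ℝ) g f j.1
      rw [hF]
    rw [hco]
    ring

/-- Consistency check: with an absorbed head the expansion collapses to `E[g] · R(f)` (`sahiE_cons_eq_ex_mul_rform`). [this work] -/
theorem sahiE_cons_eq_sum_powerset_of_absorbed (hg : ∀ j x, g x * f j x = g x) :
    ∑ S ∈ (univ : Finset (Fin n)).powerset,
        (S.card.factorial : ℝ) * ex μ (fun x => g x * ∏ j ∈ S, f j x) * ncs μ f (univ \ S) = ex μ g * rform μ f univ := by
  rw [← sahiE_cons_eq_sum_powerset, sahiE_cons_eq_ex_mul_rform μ g f hg]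

/-! ### The value-level SIGN⁻ law: a head disjoint from some member -/

/-- **SIGN⁻ at the value level, every weight.**  If the head `g` is killed by some member (`g · f_{j₀} = 0`), all head moments
`E[g · Π_{j∈S} f_j]` are `≥ 0`, and every sub-family of the tail containing `j₀` is Sahi-positive in cycle form under `μ`
(for an FKG weight and increasing `f_j` this is Sahi's `C_k`, `k ≤ n`), then `E_{n+1}(g, f_1, …, f_n) ≤ 0`: in the head block
expansion the blocks through `j₀` vanish and every other term is `|S|! · E[g·Π_S f] · (−E_{|∁S|}(f|_{∁S})) ≤ 0`. [this work] -/
theorem sahiE_cons_nonpos_of_mul_eq_zero (j₀ : Fin n) (hgf : ∀ x, g x * f j₀ x = 0)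
    (hmom : ∀ S : Finset (Fin n), 0 ≤ ex μ (fun x => g x * ∏ j ∈ S, f j x))
    (hsub : ∀ A : Finset (Fin n), j₀ ∈ A → 0 ≤ cycleSum μ (fun j : {x // x ∈ A} => f j)) :
    sahiE μ (n + 1) (Fin.cons g f) ≤ 0 := by
  classical
  rw [sahiE_cons_eq_sum_powerset]
  refine sum_nonpos fun S _ => ?_
  by_cases hj : j₀ ∈ S
  · -- the head moment vanishes
    have h0 : ex μ (fun x => g x * ∏ j ∈ S, f j x) = 0 := by
      unfold ex
      refine sum_eq_zero fun x _ => ?_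
      dsimp only
      rw [← mul_prod_erase S _ hj]
      have : μ x * (g x * (f j₀ x * ∏ j ∈ S.erase j₀, f j x)) = μ x * (g x * f j₀ x) * ∏ j ∈ S.erase j₀, f j x := by ring
      rw [this, hgf x, mul_zero, zero_mul]
    rw [h0, mul_zero, zero_mul]
  · have hA : j₀ ∈ univ \ S := mem_sdiff.2 ⟨mem_univ _, hj⟩
    rw [ncs_eq_neg_cycleSum μ f ⟨j₀, hA⟩]
    have h1 : 0 ≤ (S.card.factorial : ℝ) * ex μ (fun x => g x * ∏ j ∈ S, f j x) :=
      mul_nonneg (Nat.cast_nonneg _) (hmom S)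
    have h2 := hsub (univ \ S) hA
    nlinarith

/-- **SIGN⁻ for events, every probability weight**: `W ∩ U_{j₀} = ∅` and Sahi positivity (cycle form) of the sub-families of
`(1_{U_j})` through `j₀` give `E_{n+1}(1_W, 1_{U_1}, …, 1_{U_n}) ≤ 0` — the value-level shadow of the C-slot SIGN⁻ law. [this work] -/
theorem sahiE_setInd_cons_nonpos_of_disjoint [DecidableEq α] (hμ0 : ∀ x, 0 ≤ μ x) (W : Finset α) (U : Fin n → Finset α)
    (j₀ : Fin n) (hW : Disjoint W (U j₀))
    (hsub : ∀ A : Finset (Fin n), j₀ ∈ A → 0 ≤ cycleSum μ (fun j : {x // x ∈ A} => setInd (U j))) :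
    sahiE μ (n + 1) (Fin.cons (setInd W) (fun j => setInd (U j))) ≤ 0 := by
  refine sahiE_cons_nonpos_of_mul_eq_zero μ (setInd W) (fun j => setInd (U j)) j₀ (fun x => ?_) (fun S => ?_) hsub
  · simp only [setInd_apply]
    by_cases hx : x ∈ W
    · rw [if_pos hx, if_neg (disjoint_left.1 hW hx), mul_zero]
    · rw [if_neg hx, zero_mul]
  · unfold ex
    exact sum_nonneg fun x _ => mul_nonneg (hμ0 x)
      (mul_nonneg (setInd_nonneg _ _) (prod_nonneg fun j _ => setInd_nonneg _ _))

end HeadBlocks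

end SahiAbsorbed

end Summit.CriticalPhenomena.PercolationContinuityZ3.Theorems
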